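import Literature.NumberTheory.GaloisCohomology.BrauerSumInvCyclicClassPositive
import Literature.NumberTheory.GaloisCohomology.ArchimedeanCyclicClassEvaluation
import Literature.NumberTheory.GaloisRepresentations.HeckeCharacterGaloisAvatarProofs
import Literature.NumberTheory.GaloisRepresentations.LocalUnitGroupFiniteIndexOpen
import Literature.NumberTheory.NumberFields.IdeleOpenSubgroupFiniteIndex
import HarnessLib

/-!
# An idèle killed by every class-field character of exponent `n` unramified outside `S`
# lies in `Kˣ · U_K^S · 𝕀_Kⁿ` (existence theorem + duality; Tate, Cassels–Fröhlich VII §5.1 (D))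

Let `K` be a number field, `n ≥ 1`, `S` a finite set of finite places, and
`U_K^S = unitIdelesOutside K S` (idèles which are `1` at `S ∪ S_∞` and units elsewhere).  The subgroup
`N = Kˣ · U_K^S · 𝕀_Kⁿ` of the idèle group is OPEN (it contains the neighbourhood of `1` made of the unit
idèles whose components at `v ∈ S` lie in the open subgroups `(K_vˣ)ⁿ` and whose real components are
positive — archimedean idèles positive at the real places are `n`-th powers) and contains `Kˣ`, hence has
finite index (`finiteIndex_of_isOpen_of_principalIdeles_le`), and `𝕀_K/N` has exponent dividing `n`.  By
the duality of finite abelian groups every `ξ ∉ N` is detected by a character `φ : 𝕀_K/N → ℂˣ`; `φ` is a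
Hecke character of finite order (`heckeOfIdeleQuotientChar`), hence by the EXISTENCE THEOREM in character
form (`HeckeCharacter.exists_eq_charHecke_of_isFiniteOrder`, Tate VII §5.1 (B)+(D)) of the form
`χ ∘ ψ_{L|K}` for a finite abelian `L ⊆ K̄` and a character `χ` of `Gal(L/K)`; this `χ` satisfies `χⁿ = 1`
(`ψ_{L|K}` is onto) and kills `ψ_{L|K}⟨𝒪_wˣ⟩` for `w ∉ S` (`⟨𝒪_wˣ⟩ ⊆ U_K^S ⊆ N`).  Hence:

**Theorem** (`exists_eq_principalIdele_mul_mul_pow_of_forall_character`).  If `χ(ψ_{L|K} ξ) = 1` for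
every finite abelian `L ⊆ K̄` and every character `χ` of `Gal(L/K)` with `χⁿ = 1` which kills
`ψ_{L|K}⟨u⟩_w` for all `w ∉ S` and all local units `u ∈ 𝒪_wˣ`, then `ξ = (a) · u · yⁿ` with `a ∈ Kˣ`,
`u ∈ U_K^S`, `y ∈ 𝕀_K`.

This is the class-field-theoretic core (the «existence-theorem half») of the `μₙ`-case of Poitou–Tate's
`Ker γ¹ ⊆ Im β¹` (Milne *ADT* I Thm. 4.10(b)): with `ξ = (x_v)_{v ∈ S}`, `a ≡ x_v (mod (K_vˣ)ⁿ)` on `S` and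
`n ∣ ord_w(a)` off `S`, i.e. the Kummer class `κₙ(a)` is unramified outside `S` and localises to the
prescribed classes.  Proof file: theorems only (no definition, no named fact, no instance; D-0026).
HONEST FRAMING: textbook; proves no case of Poitou–Tate duality for a general module and no case of BSD
(cell bsd-schneider-ideate, crux `AnticycControlAdditiveK`, FINDING door-c6 g6 §4 node N2).

## References

* J. Tate, *Global class field theory*, Ch. VII of Cassels–Fröhlich (1967), §5.1 Main Theorem (B), (D) and
  the remark after (D). [CasselsFrohlichANT1967]
* J. Neukirch, *Algebraic Number Theory* (1999), Ch. VI Thm. (6.1) (existence theorem), §1. [NeukirchANT1999]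
* J. S. Milne, *Arithmetic Duality Theorems*, 2nd ed. (2006), I Thm. 4.10(b). [MilneADT2006]

## Tree search

`lean search 'unitIdelesOutside|heckeOfIdeleQuotientChar|exists_eq_charHecke_of_isFiniteOrder'`: the inputs
(`GlobalExistenceTheoremReductionProofs`, `GlobalReciprocityCharacterFormProofs`, `HeckeCharacterGaloisAvatarProofs`);
no prior statement of this separation form.  Also used: `isOpen_unitIdeles`, `isOpen_range_powMonoidHom_units`,
`exists_pow_eq_of_pos/_of_isComplex` (`ArchimedeanCyclicClassEvaluation`), `finiteIndex_of_isOpen_of_principalIdeles_le`,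
Mathlib `CommGroup.exists_apply_ne_one_of_hasEnoughRootsOfUnity`.
-/

noncomputable section

open Function NumberField IsDedekindDomain Field
open scoped NumberField Topology

namespace Literature.NumberTheory.NumberFields

open Literature.NumberTheory.GaloisRepresentations
open Literature.NumberTheory.GaloisCohomology

variable {K : Type} [Field K] [NumberField K]

/-! ### §1. Idèle bookkeeping: `x = ∏_{v ∈ S} ⟨x_v⟩_v · (x_∞) · u`, `u ∈ U_K^S` -/

section Decomposition

/-- **`x = ∏_{v ∈ S} ⟨x_v⟩_v · (x_∞) · u` with `u ∈ U_K^S`** for every idèle `x` which is a unit at the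
finite places outside `S` (componentwise bookkeeping in `𝕀_K`; the tree's
`principalIdele_mem_mul_unitIdelesOutside` is the case of a principal idèle).
[cite: Neukirch2013, Part III §7, p. 175] -/
theorem exists_eq_prod_localUnits_mul_infiniteIdeles_mul (x : ideleGroup K) (S : Finset (HeightOneSpectrum (𝓞 K)))
    (hS : ∀ v ∉ S, Valued.v ((x : AdeleRing (𝓞 K) K).2 v) = 1) :
    ∃ u ∈ unitIdelesOutside K S, x =
      (∏ v ∈ S, localUnits v ((ideleGroup.finComp v).toHomUnits x)) *
        infiniteIdeles K (ideleGroup.infComp.toHomUnits x) * u := by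
  classical
  set w : ideleGroup K := (∏ v ∈ S, localUnits v ((ideleGroup.finComp v).toHomUnits x)) *
    infiniteIdeles K (ideleGroup.infComp.toHomUnits x) with hwdef
  refine ⟨w⁻¹ * x, ?_, by rw [← mul_assoc, mul_inv_cancel, one_mul]⟩
  have hw1 : (w : AdeleRing (𝓞 K) K).1 = (x : AdeleRing (𝓞 K) K).1 := by
    rw [hwdef, ideleGroup_val_fst_mul, fst_prod_localUnits, one_mul, infiniteIdeles_fst]
    rfl
  have hw2 : ∀ v, (w : AdeleRing (𝓞 K) K).2 v =
      if v ∈ S then (x : AdeleRing (𝓞 K) K).2 v else 1 := by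
    intro v
    rw [hwdef, ideleGroup_val_snd_mul, infiniteIdeles_snd, mul_one, snd_prod_localUnits]
    split_ifs <;> rfl
  refine ⟨?_, fun v hv => ?_, fun v => ?_⟩
  · have h : ((w⁻¹ * x : ideleGroup K) : AdeleRing (𝓞 K) K).1 =
        ((w⁻¹ * w : ideleGroup K) : AdeleRing (𝓞 K) K).1 := by
      rw [ideleGroup_val_fst_mul, ideleGroup_val_fst_mul, hw1]
    rw [h, inv_mul_cancel]; rfl
  · have h : ((w⁻¹ * x : ideleGroup K) : AdeleRing (𝓞 K) K).2 v =
        ((w⁻¹ * w : ideleGroup K) : AdeleRing (𝓞 K) K).2 v := by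
      rw [ideleGroup_val_snd_mul, ideleGroup_val_snd_mul, hw2, if_pos hv]
    rw [h, inv_mul_cancel]; rfl
  · by_cases hv : v ∈ S
    · have h : ((w⁻¹ * x : ideleGroup K) : AdeleRing (𝓞 K) K).2 v =
          ((w⁻¹ * w : ideleGroup K) : AdeleRing (𝓞 K) K).2 v := by
        rw [ideleGroup_val_snd_mul, ideleGroup_val_snd_mul, hw2, if_pos hv]
      rw [h, inv_mul_cancel]
      exact (unitIdeles K).one_mem v
    · rw [ideleGroup_val_snd_mul, ideleGroup_val_inv_snd, hw2, if_neg hv, inv_one, one_mul]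
      exact hS v hv

omit [NumberField K] in
/-- **An archimedean idèle positive at every real place is an `n`-th power of `K_∞ˣ`** (`n ≥ 1`):
positive reals and all complex numbers are `n`-th powers (`exists_pow_eq_of_pos`, `exists_pow_eq_of_isComplex`).
[cite: NeukirchANT1999, Ch. VI §5 Prop. (5.6)] -/
theorem exists_units_infiniteAdeleRing_eq_pow {n : ℕ} [NeZero n] (u : (InfiniteAdeleRing K)ˣ)
    (hu : ∀ (w : InfinitePlace K) (hw : w.IsReal),
      0 < InfinitePlace.Completion.extensionEmbeddingOfIsReal hw ((u : InfiniteAdeleRing K) w)) :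
    ∃ t : (InfiniteAdeleRing K)ˣ, u = t ^ n := by
  let e := (ContinuousMulEquiv.piUnits (M := fun w : InfinitePlace K => w.Completion))
  have hpow : ∀ w, ∃ r : (w.Completion)ˣ, e (u : (Π w : InfinitePlace K, w.Completion)ˣ) w = r ^ n := by
    intro w
    set z : (w.Completion)ˣ := e (u : (Π w : InfinitePlace K, w.Completion)ˣ) w with hz
    have hzval : (z : w.Completion) = (u : InfiniteAdeleRing K) w := rfl
    obtain ⟨t, ht⟩ : ∃ t : w.Completion, (z : w.Completion) = t ^ n := by
      rcases w.isReal_or_isComplex with hw | hw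
      · exact exists_pow_eq_of_pos hw _ (by rw [hzval]; exact hu w hw)
      · exact exists_pow_eq_of_isComplex hw (NeZero.pos n) _
    have ht0 : t ≠ 0 := fun h => z.ne_zero (by rw [ht, h, zero_pow (NeZero.ne n)])
    exact ⟨Units.mk0 t ht0, Units.ext (by rw [Units.val_pow_eq_pow_val, Units.val_mk0, ← ht])⟩
  choose r hr using hpow
  refine ⟨(e.symm r : (Π w : InfinitePlace K, w.Completion)ˣ), ?_⟩
  apply e.injective
  change e (u : (Π w : InfinitePlace K, w.Completion)ˣ) = e ((e.symm r) ^ n)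
  rw [map_pow, e.apply_symm_apply]
  funext w
  rw [Pi.pow_apply]
  exact hr w

end Decomposition

/-! ### §2. The subgroup `Kˣ · U_K^S · 𝕀_Kⁿ` is open of finite index -/

section Open

/-- **`U_K^S · 𝕀_Kⁿ` is a neighbourhood of `1`**: it contains the unit idèles whose components at `v ∈ S`
lie in the OPEN subgroups `(K_vˣ)ⁿ` (`isOpen_range_powMonoidHom_units`, Neukirch II (5.7)) and whose real
components are positive (then the archimedean part is an `n`-th power). [cite: NeukirchANT1999, Ch. II Prop. (5.7), Ch. VI §1] -/
theorem unitIdelesOutside_sup_range_pow_mem_nhds_one {n : ℕ} [NeZero n] (S : Finset (HeightOneSpectrum (𝓞 K))) :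
    ((unitIdelesOutside K S ⊔ (powMonoidHom n : ideleGroup K →* ideleGroup K).range : Subgroup (ideleGroup K)) :
      Set (ideleGroup K)) ∈ 𝓝 (1 : ideleGroup K) := by
  classical
  -- at each finite place, a neighbourhood of `1` in `K_v` made of `n`-th powers of units
  have hO : ∀ v : HeightOneSpectrum (𝓞 K), ∃ O ∈ 𝓝 (1 : v.adicCompletion K),
      ∀ u : (v.adicCompletion K)ˣ, (u : v.adicCompletion K) ∈ O →
        u ∈ (powMonoidHom n : (v.adicCompletion K)ˣ →* (v.adicCompletion K)ˣ).range := by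
    intro v
    haveI : CharZero (v.adicCompletion K) := charZero_adicCompletion v
    have hopen := isOpen_range_powMonoidHom_units (v.adicCompletion K) (n := n)
      (Nat.cast_ne_zero.mpr (NeZero.ne n))
    have hmem : ((powMonoidHom n : (v.adicCompletion K)ˣ →* (v.adicCompletion K)ˣ).range :
        Set (v.adicCompletion K)ˣ) ∈ 𝓝 (1 : (v.adicCompletion K)ˣ) := hopen.mem_nhds (Subgroup.one_mem _)
    rw [Units.isEmbedding_val₀.nhds_eq_comap, Units.val_one, Filter.mem_comap] at hmem
    obtain ⟨O, hO, hsub⟩ := hmem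
    exact ⟨O, hO, fun u hu => hsub hu⟩
  choose O hOmem hOpow using hO
  -- the neighbourhood `W`
  set W : Set (ideleGroup K) := (unitIdeles K : Set (ideleGroup K)) ∩
    ((⋂ v ∈ S, {x : ideleGroup K | (x : AdeleRing (𝓞 K) K).2 v ∈ O v}) ∩
      ⋂ w : InfinitePlace K, {x : ideleGroup K | ∀ hw : w.IsReal,
        0 < InfinitePlace.Completion.extensionEmbeddingOfIsReal hw ((x : AdeleRing (𝓞 K) K).1 w)}) with hW
  have hWmem : W ∈ 𝓝 (1 : ideleGroup K) := by
    refine Filter.inter_mem ((isOpen_unitIdeles K).mem_nhds (unitIdeles K).one_mem) (Filter.inter_mem ?_ ?_)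
    · refine (Filter.biInter_finset_mem S).mpr fun v _ => ?_
      have h1 : O v ∈ 𝓝 ((fun x : ideleGroup K => (x : AdeleRing (𝓞 K) K).2 v) 1) := hOmem v
      exact (continuous_ideleGroup_snd_apply v).continuousAt.preimage_mem_nhds h1
    · refine (Filter.iInter_mem).mpr fun w => ?_
      by_cases hw : w.IsReal
      · have hc : Continuous fun x : ideleGroup K =>
            InfinitePlace.Completion.extensionEmbeddingOfIsReal hw ((x : AdeleRing (𝓞 K) K).1 w) :=
          (InfinitePlace.Completion.isometry_extensionEmbeddingOfIsReal hw).continuous.comp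
            (continuous_ideleGroup_fst_apply w)
        have hset : {x : ideleGroup K | ∀ hw' : w.IsReal,
            0 < InfinitePlace.Completion.extensionEmbeddingOfIsReal hw' ((x : AdeleRing (𝓞 K) K).1 w)} =
            (fun x : ideleGroup K =>
              InfinitePlace.Completion.extensionEmbeddingOfIsReal hw ((x : AdeleRing (𝓞 K) K).1 w)) ⁻¹' Set.Ioi 0 := by
          ext x
          simp only [Set.mem_setOf_eq, Set.mem_preimage, Set.mem_Ioi]
          exact ⟨fun h => h hw, fun h _ => h⟩
        rw [hset]
        refine hc.continuousAt.preimage_mem_nhds (isOpen_Ioi.mem_nhds ?_)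
        change 0 < InfinitePlace.Completion.extensionEmbeddingOfIsReal hw (((1 : ideleGroup K) : AdeleRing (𝓞 K) K).1 w)
        have : (((1 : ideleGroup K) : AdeleRing (𝓞 K) K).1 w) = 1 := rfl
        rw [this, map_one]; exact one_pos
      · have hset : {x : ideleGroup K | ∀ hw' : w.IsReal,
            0 < InfinitePlace.Completion.extensionEmbeddingOfIsReal hw' ((x : AdeleRing (𝓞 K) K).1 w)} = Set.univ :=
          Set.eq_univ_of_forall fun x hw' => absurd hw' hw
        rw [hset]; exact Filter.univ_mem
  refine Filter.mem_of_superset hWmem fun x hx => ?_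
  obtain ⟨hxU, hxO, hxpos⟩ := hx
  rw [Set.mem_iInter₂] at hxO
  rw [Set.mem_iInter] at hxpos
  -- decompose `x`
  obtain ⟨u, hu, hdec⟩ := exists_eq_prod_localUnits_mul_infiniteIdeles_mul x S fun v _ => hxU v
  -- the finite part at `S` is an `n`-th power
  have hfin : (∏ v ∈ S, localUnits v ((ideleGroup.finComp v).toHomUnits x)) ∈
      (powMonoidHom n : ideleGroup K →* ideleGroup K).range := by
    refine Subgroup.prod_mem _ fun v hv => ?_
    obtain ⟨y, hy⟩ := hOpow v ((ideleGroup.finComp v).toHomUnits x) (hxO v hv)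
    exact ⟨localUnits v y, by rw [powMonoidHom_apply, ← map_pow, ← powMonoidHom_apply, hy]⟩
  -- the archimedean part is an `n`-th power
  have hinf : infiniteIdeles K (ideleGroup.infComp.toHomUnits x) ∈
      (powMonoidHom n : ideleGroup K →* ideleGroup K).range := by
    obtain ⟨t, ht⟩ := exists_units_infiniteAdeleRing_eq_pow (n := n) (ideleGroup.infComp.toHomUnits x)
      fun w hw => hxpos w hw
    exact ⟨infiniteIdeles K t, by rw [powMonoidHom_apply, ← map_pow, ← ht]⟩
  rw [hdec, SetLike.mem_coe]
  exact Subgroup.mul_mem _ (Subgroup.mem_sup_right (Subgroup.mul_mem _ hfin hinf)) (Subgroup.mem_sup_left hu)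

/-- **`Kˣ · U_K^S · 𝕀_Kⁿ` is open** (a subgroup containing a neighbourhood of `1`).
[cite: NeukirchANT1999, Ch. VI §1] -/
theorem isOpen_principalIdeles_sup_unitIdelesOutside_sup_range_pow {n : ℕ} [NeZero n]
    (S : Finset (HeightOneSpectrum (𝓞 K))) :
    IsOpen ((principalIdeles K ⊔ (unitIdelesOutside K S ⊔ (powMonoidHom n : ideleGroup K →* ideleGroup K).range) :
      Subgroup (ideleGroup K)) : Set (ideleGroup K)) :=
  Subgroup.isOpen_of_mem_nhds _ (Filter.mem_of_superset (unitIdelesOutside_sup_range_pow_mem_nhds_one S)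
    (SetLike.coe_subset_coe.mpr le_sup_right))

end Open

/-! ### §3. The separation theorem -/

section Separation

/-- **An idèle killed by every class-field character of exponent `n` unramified outside `S` lies in
`Kˣ · U_K^S · 𝕀_Kⁿ`** (Tate, Cassels–Fröhlich VII §5.1 (B), (D): the existence theorem in character form
+ duality of the finite group `𝕀_K/(Kˣ U_K^S 𝕀_Kⁿ)`; see the module docstring).  Hypothesis: for every finite
abelian `L ⊆ K̄` and every character `χ` of `Gal(L/K)` with `χⁿ = 1` killing `ψ_{L|K}⟨u⟩_w` for all finite
`w ∉ S` and all `u ∈ 𝒪_wˣ`, `χ(ψ_{L|K} ξ) = 1`.  Conclusion: `ξ = (a) · u · yⁿ`, `a ∈ Kˣ`, `u ∈ U_K^S`,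
`y ∈ 𝕀_K`. [cite: CasselsFrohlichANT1967, Ch. VII §5.1 Main Theorem (B), (D)] [cite: NeukirchANT1999, Ch. VI Thm. (6.1)] -/
theorem exists_eq_principalIdele_mul_mul_pow_of_forall_character {n : ℕ} [NeZero n]
    (S : Finset (HeightOneSpectrum (𝓞 K))) (ξ : ideleGroup K)
    (hξ : ∀ (L : IntermediateField K (AlgebraicClosure K)) [FiniteDimensional K L] [IsAbelianGalois K L]
      [NumberField L] (χ : (L ≃ₐ[K] L) →* ℂˣ), (∀ g, χ g ^ n = 1) →
      (∀ w : HeightOneSpectrum (𝓞 K), w ∉ S → ∀ u : (w.adicCompletion K)ˣ,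
        Valued.v (u : w.adicCompletion K) = 1 →
        χ (artinIdeleMap L artinReciprocity_character_holds (localUnits w u)) = 1) →
      χ (artinIdeleMap L artinReciprocity_character_holds ξ) = 1) :
    ∃ (a : Kˣ) (u : ideleGroup K) (y : ideleGroup K), u ∈ unitIdelesOutside K S ∧
      ξ = principalIdele K a * u * y ^ n := by
  classical
  set hR := artinReciprocity_character_holds
  set P : Subgroup (ideleGroup K) := (powMonoidHom n : ideleGroup K →* ideleGroup K).range with hPdef
  set N : Subgroup (ideleGroup K) := principalIdeles K ⊔ (unitIdelesOutside K S ⊔ P) with hNdef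
  have hPN : principalIdeles K ≤ N := le_sup_left
  have hNopen : IsOpen (N : Set (ideleGroup K)) := isOpen_principalIdeles_sup_unitIdelesOutside_sup_range_pow S
  haveI hNfi : N.FiniteIndex := finiteIndex_of_isOpen_of_principalIdeles_le N hNopen hPN
  haveI : Finite (ideleGroup K ⧸ N) := Subgroup.finite_quotient_of_finiteIndex
  -- `𝕀_K/N` has exponent dividing `n`, so `ℂ` has enough roots of unity
  have hpowN : ∀ x : ideleGroup K, x ^ n ∈ N := fun x =>
    Subgroup.mem_sup_right (Subgroup.mem_sup_right ⟨x, rfl⟩)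
  have hexp : Monoid.exponent (ideleGroup K ⧸ N) ∣ n := by
    refine Monoid.exponent_dvd_of_forall_pow_eq_one fun q => ?_
    obtain ⟨x, rfl⟩ := QuotientGroup.mk_surjective q
    rw [← QuotientGroup.mk_pow, QuotientGroup.eq_one_iff]
    exact hpowN x
  haveI : HasEnoughRootsOfUnity ℂ (Monoid.exponent (ideleGroup K ⧸ N)) := by
    haveI : NeZero ((n : ℕ) : ℂ) := ⟨Nat.cast_ne_zero.mpr (NeZero.ne n)⟩
    exact HasEnoughRootsOfUnity.of_dvd ℂ hexp
  -- it suffices to show `ξ ∈ N`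
  suffices hmem : ξ ∈ N by
    obtain ⟨p, hp, z, hz, hpz⟩ := Subgroup.mem_sup.mp hmem
    obtain ⟨u, hu, y', hy', huy⟩ := Subgroup.mem_sup.mp hz
    obtain ⟨a, rfl⟩ := hp
    obtain ⟨y, rfl⟩ := hy'
    exact ⟨a, u, y, hu, by rw [← hpz, ← huy, powMonoidHom_apply, mul_assoc]; rfl⟩
  -- if not, a character of `𝕀_K/N` detects `ξ`
  by_contra hξN
  have hne : (QuotientGroup.mk ξ : ideleGroup K ⧸ N) ≠ 1 := fun h => hξN ((QuotientGroup.eq_one_iff ξ).mp h)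
  obtain ⟨φ, hφ⟩ := CommGroup.exists_apply_ne_one_of_hasEnoughRootsOfUnity (ideleGroup K ⧸ N) ℂ hne
  -- the Hecke character of `φ` and its class-field avatar
  set η := heckeOfIdeleQuotientChar N hPN hNopen φ with hηdef
  have hηfin : η.IsFiniteOrder := isFiniteOrder_heckeOfIdeleQuotientChar N hPN hNopen φ
  obtain ⟨L, hLfd, hLab, χ, hηχ⟩ := η.exists_eq_charHecke_of_isFiniteOrder hηfin
  haveI := hLfd; haveI := hLab
  haveI : NumberField L := NumberField.of_module_finite K L
  have hχapply : ∀ x : ideleGroup K, χ (artinIdeleMap L hR x) = φ (QuotientGroup.mk x) := fun x => by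
    rw [apply_artinIdeleMap, ← hηχ, hηdef, heckeOfIdeleQuotientChar_apply]
  -- `χⁿ = 1`
  have hχn : ∀ g, χ g ^ n = 1 := by
    intro g
    obtain ⟨x, rfl⟩ := artinIdeleMap_surjective L hR g
    rw [← map_pow, ← map_pow, hχapply, (QuotientGroup.eq_one_iff _).mpr (hpowN x), map_one]
  -- `χ` kills `ψ_{L|K}⟨𝒪_wˣ⟩` for `w ∉ S`
  have hχunr : ∀ w : HeightOneSpectrum (𝓞 K), w ∉ S → ∀ u : (w.adicCompletion K)ˣ,
      Valued.v (u : w.adicCompletion K) = 1 → χ (artinIdeleMap L hR (localUnits w u)) = 1 := by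
    intro w hw u hu
    have hmem : localUnits w u ∈ N := by
      refine Subgroup.mem_sup_right (Subgroup.mem_sup_left ⟨localUnits_fst w u, fun v hv => ?_, fun v => ?_⟩)
      · exact localUnits_snd_apply_of_ne u (fun h => hw (h ▸ hv))
      · by_cases h : v = w
        · subst h; rw [localUnits_snd_apply_self]; exact hu
        · rw [localUnits_snd_apply_of_ne u h, map_one]
    rw [hχapply, (QuotientGroup.eq_one_iff _).mpr hmem, map_one]
  -- contradiction
  have h1 := hξ L χ hχn hχunr
  rw [hχapply] at h1
  exact hφ h1

end Separation

end Literature.NumberTheory.NumberFields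

end
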